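import Mathlib.RingTheory.MvPolynomial.Homogeneous
import Mathlib.Combinatorics.Nullstellensatz
import Mathlib.Algebra.MvPolynomial.Equiv
import Mathlib.Algebra.Polynomial.BigOperators
import Mathlib.Algebra.Polynomial.Degree.Lemmas
import HarnessLib

/-!
# The linear coordinate change of Noether normalisation, with explicit small coefficients

The first step of the proof of the Noether normalisation theorem over an infinite field
(Greuel–Pfister, *A Singular Introduction to Commutative Algebra* (2002), Thm. 3.4.1 and its proof,
p. 213–214): for a nonzero polynomial `f` of degree `d` with top homogeneous part `f_d`, the linear
change of coordinates `x_i = ∑_j m_{ij} y_j` gives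
`f_d(x) = f_d(m_{11}, …, m_{n1}) · y_1^d + (lower terms in y_1)`, "and the condition
`f_d(m_{11}, …, m_{n1}) ≠ 0` can be satisfied as `K` is infinite"; then `y_1` is integral over
`K[y_2, …, y_n]` modulo `f`. Mathlib's `Mathlib.RingTheory.NoetherNormalization` uses Nagata's
non-linear substitution `X_i ↦ X_i + X_0^{r_i}` and keeps every step private; for quantitative work
(heights / weights of the transformed system, e.g. Bürgisser 2000 TCS §4) one needs the LINEAR
change with coefficients taken from a prescribed finite set of size `> deg f`, which is what this
file provides, over any integral domain.

We single out the variable `X_0` of `MvPolynomial (Fin (n + 1)) R` (as Mathlib does) and use the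
shear `X_0 ↦ X_0`, `X_{i+1} ↦ X_{i+1} + v_i X_0` (`linearChange v`, an `R`-algebra automorphism with
inverse `linearChange (-v)`). Writing the result as a polynomial in `X_0` over `R[X_1, …, X_n]`
(`MvPolynomial.finSuccEquiv`), its degree is `≤ deg f` and its coefficient at `X_0^{deg f}` is the
constant `f_d(1, v_1, …, v_n)` (`coeff_finSuccEquiv_linearChange_totalDegree`); the dehomogenised
top part `f_d(1, Y_1, …, Y_n)` is a nonzero polynomial of degree `≤ d` (`dehomTop_ne_zero`), so Alon's
Combinatorial Nullstellensatz (Mathlib) produces `v ∈ Sⁿ` for any finite `S ⊆ R` with `#S > d`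
making that constant nonzero (`exists_linearChange_leadingCoeff`); over a field the transformed
polynomial becomes monic in `X_0` after scaling (`exists_linearChange_monic`).

## Contents (namespace `Literature.RingTheory.NoetherNormalization`, everything proved)

* `linearChange`, `linearChange_X_zero`, `linearChange_X_succ`, `linearChange_comp_neg`,
  `linearChangeEquiv` — the shear and its inverse;
* `toPolyChange` (= `finSuccEquiv ∘ linearChange`, `toPolyChange_eq`), `natDegree_toPolyChange_monomial_le`,
  `coeff_toPolyChange_monomial_degree`, `natDegree_toPolyChange_le`,
  `coeff_finSuccEquiv_linearChange_totalDegree` — degree and top coefficient in `X_0`;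
* `dehomTop`, `eval_dehomTop`, `dehomTop_ne_zero`, `totalDegree_dehomTop_le` — the dehomogenised top
  component `f_d(1, Y)`;
* `exists_linearChange_leadingCoeff` — **the quantitative normalisation step** over a domain: some
  `v ∈ Sⁿ` (`#S > deg f`) makes `linearChange v f` of `X_0`-degree exactly `deg f` with leading
  coefficient a nonzero constant;
* `exists_linearChange_monic` — the field case, monic after scaling.

What is NOT here: the iteration to a full Noether normalisation (choice of `f` in elimination
ideals) and the integrality packaging in quotient rings (Mathlib: a monic relation gives
`IsIntegral` directly).

## References

* G.-M. Greuel, G. Pfister, *A Singular Introduction to Commutative Algebra*, Springer (2002),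
  Thm. 3.4.1 (5) and its proof (linear change `f_d(M y) = f_d(m_{11},…,m_{n1}) y_1^d + …`).
* N. Alon, Combinatorial Nullstellensatz, Combin. Probab. Comput. 8 (1999) 7–29, Thm. 1.2
  (Mathlib `MvPolynomial.combinatorial_nullstellensatz_exists_eval_nonzero`).
-/

noncomputable section

open MvPolynomial Finset

namespace Literature.RingTheory.NoetherNormalization

variable {R : Type*} [CommRing R] {n : ℕ}

/-! ### The shear `X_0 ↦ X_0`, `X_{i+1} ↦ X_{i+1} + v_i X_0` -/

/-- The linear change of coordinates `X_0 ↦ X_0`, `X_{i+1} ↦ X_{i+1} + v_i · X_0` of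
`R[X_0, …, X_n]` (the shear used in the proof of Noether normalisation over infinite fields,
Greuel–Pfister 2002, proof of Thm. 3.4.1, with `y_1 = X_0`). [cite: GreuelPfister2002, Thm. 3.4.1 (proof)] -/
def linearChange (v : Fin n → R) : MvPolynomial (Fin (n + 1)) R →ₐ[R] MvPolynomial (Fin (n + 1)) R :=
  aeval (Fin.cons (X 0) fun i => X i.succ + C (v i) * X 0)

/-- The shear fixes `X_0`. [folklore] -/
@[simp] theorem linearChange_X_zero (v : Fin n → R) : linearChange v (X 0) = X 0 := by
  simp [linearChange]

/-- The shear sends `X_{i+1}` to `X_{i+1} + v_i X_0`. [folklore] -/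
@[simp] theorem linearChange_X_succ (v : Fin n → R) (i : Fin n) :
    linearChange v (X i.succ) = X i.succ + C (v i) * X 0 := by
  simp [linearChange]

/-- `linearChange v ∘ linearChange (-v) = id`. [folklore] -/
theorem linearChange_comp_neg (v : Fin n → R) :
    (linearChange v).comp (linearChange (-v)) = AlgHom.id R _ := by
  refine MvPolynomial.algHom_ext fun j => ?_
  refine Fin.cases ?_ (fun i => ?_) j
  · simp
  · simp only [AlgHom.comp_apply, linearChange_X_succ, Pi.neg_apply, map_add, map_mul,
      linearChange_X_zero, AlgHom.id_apply, MvPolynomial.algHom_C, MvPolynomial.algebraMap_eq,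
      map_neg]
    ring

/-- The shear as an `R`-algebra automorphism of `R[X_0, …, X_n]`, inverse `linearChange (-v)`.
[folklore] -/
def linearChangeEquiv (v : Fin n → R) :
    MvPolynomial (Fin (n + 1)) R ≃ₐ[R] MvPolynomial (Fin (n + 1)) R :=
  AlgEquiv.ofAlgHom (linearChange v) (linearChange (-v)) (linearChange_comp_neg v)
    (by simpa using linearChange_comp_neg (-v))

/-- `linearChangeEquiv v` acts as `linearChange v`. [folklore] -/
@[simp] theorem linearChangeEquiv_apply (v : Fin n → R) (f : MvPolynomial (Fin (n + 1)) R) :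
    linearChangeEquiv v f = linearChange v f := rfl

/-! ### The transformed polynomial as a polynomial in `X_0` -/

/-- `finSuccEquiv ∘ linearChange v` written directly as an evaluation: `X_0 ↦ T`,
`X_{i+1} ↦ X_i + v_i T` in `(R[X_1, …, X_n])[T]`. [folklore] -/
def toPolyChange (v : Fin n → R) :
    MvPolynomial (Fin (n + 1)) R →ₐ[R] Polynomial (MvPolynomial (Fin n) R) :=
  aeval (Fin.cons Polynomial.X fun i => Polynomial.C (X i) + Polynomial.C (C (v i)) * Polynomial.X)

/-- `toPolyChange v f = finSuccEquiv (linearChange v f)`. [folklore] -/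
theorem toPolyChange_eq (v : Fin n → R) (f : MvPolynomial (Fin (n + 1)) R) :
    toPolyChange v f = finSuccEquiv R n (linearChange v f) := by
  have : toPolyChange v = ((finSuccEquiv R n).toAlgHom).comp (linearChange v) := by
    refine MvPolynomial.algHom_ext fun j => ?_
    refine Fin.cases ?_ (fun i => ?_) j
    · simp [toPolyChange, finSuccEquiv_X_zero]
    · simp [toPolyChange, finSuccEquiv_apply, map_add, map_mul]
  rw [this]; rfl

/-- A linear polynomial `C a + C b · T` has degree `≤ 1`. [folklore] -/
theorem natDegree_C_add_C_mul_X_le {A : Type*} [CommRing A] (a b : A) :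
    (Polynomial.C a + Polynomial.C b * Polynomial.X).natDegree ≤ 1 :=
  (Polynomial.natDegree_add_le _ _).trans
    (max_le (by simp) ((Polynomial.natDegree_C_mul_le _ _).trans Polynomial.natDegree_X_le))

/-- Its coefficient of `T` is `b`. [folklore] -/
theorem coeff_C_add_C_mul_X_one {A : Type*} [CommRing A] (a b : A) :
    (Polynomial.C a + Polynomial.C b * Polynomial.X).coeff 1 = b := by
  simp [Polynomial.coeff_C]

/-- A product `∏ L_i^{e_i}` of powers of polynomials of degree `≤ 1` has degree `≤ ∑ e_i`.
[folklore] -/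
theorem natDegree_prod_pow_le {A : Type*} [CommSemiring A] {ι : Type*} (s : Finset ι)
    (L : ι → Polynomial A) (e : ι → ℕ) (hL : ∀ i ∈ s, (L i).natDegree ≤ 1) :
    (∏ i ∈ s, L i ^ e i).natDegree ≤ ∑ i ∈ s, e i := by
  classical
  induction s using Finset.induction_on with
  | empty => simp
  | insert a s ha ih =>
    rw [Finset.prod_insert ha, Finset.sum_insert ha]
    refine Polynomial.natDegree_mul_le.trans
      (add_le_add ?_ (ih fun i hi => hL i (Finset.mem_insert_of_mem hi)))
    calc (L a ^ e a).natDegree ≤ e a * (L a).natDegree := Polynomial.natDegree_pow_le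
      _ ≤ e a * 1 := Nat.mul_le_mul_left _ (hL a (Finset.mem_insert_self a s))
      _ = e a := mul_one _

/-- … and its coefficient in degree `∑ e_i` is `∏ (coeff₁ L_i)^{e_i}`. [folklore] -/
theorem coeff_prod_pow_sum {A : Type*} [CommSemiring A] {ι : Type*} (s : Finset ι)
    (L : ι → Polynomial A) (e : ι → ℕ) (hL : ∀ i ∈ s, (L i).natDegree ≤ 1) :
    (∏ i ∈ s, L i ^ e i).coeff (∑ i ∈ s, e i) = ∏ i ∈ s, (L i).coeff 1 ^ e i := by
  classical
  induction s using Finset.induction_on with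
  | empty => simp
  | insert a s ha ih =>
    have hs : ∀ i ∈ s, (L i).natDegree ≤ 1 := fun i hi => hL i (Finset.mem_insert_of_mem hi)
    have ha1 : (L a).natDegree ≤ 1 := hL a (Finset.mem_insert_self a s)
    have hpow : (L a ^ e a).natDegree ≤ e a :=
      calc (L a ^ e a).natDegree ≤ e a * (L a).natDegree := Polynomial.natDegree_pow_le
        _ ≤ e a * 1 := Nat.mul_le_mul_left _ ha1
        _ = e a := mul_one _
    rw [Finset.prod_insert ha, Finset.sum_insert ha, Finset.prod_insert ha,
      Polynomial.coeff_mul_add_eq_of_natDegree_le hpow (natDegree_prod_pow_le s L e hs), ih hs]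
    congr 1
    have h := Polynomial.coeff_pow_of_natDegree_le (m := e a) ha1
    rwa [mul_one] at h

/-- The image of a monomial `c · X^m` under the shear has `X_0`-degree at most `|m|`.
[cite: GreuelPfister2002, Thm. 3.4.1 (proof)] -/
theorem natDegree_toPolyChange_monomial_le (v : Fin n → R) (m : Fin (n + 1) →₀ ℕ) (c : R) :
    (toPolyChange v (monomial m c)).natDegree ≤ m.degree := by
  rw [toPolyChange, aeval_monomial, Finsupp.prod_fintype _ _ (fun i => by simp),
    Fin.prod_univ_succ, Finsupp.degree_eq_sum, Fin.sum_univ_succ]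
  simp only [Fin.cons_zero, Fin.cons_succ]
  refine (Polynomial.natDegree_mul_le).trans ?_
  have h0 : (algebraMap R (Polynomial (MvPolynomial (Fin n) R)) c).natDegree = 0 := by
    rw [Polynomial.algebraMap_apply]
    exact Polynomial.natDegree_C _
  rw [h0, zero_add]
  exact (Polynomial.natDegree_mul_le).trans (add_le_add (Polynomial.natDegree_X_pow_le _)
    (natDegree_prod_pow_le _ _ _ fun i _ => natDegree_C_add_C_mul_X_le _ _))

/-- The coefficient of `X_0^{|m|}` in the image of `c · X^m` under the shear is the constant
`c · ∏ v_i^{m_{i+1}}` (= `c · X^m` evaluated at `(1, v)`).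
[cite: GreuelPfister2002, Thm. 3.4.1 (proof)] -/
theorem coeff_toPolyChange_monomial_degree (v : Fin n → R) (m : Fin (n + 1) →₀ ℕ) (c : R) :
    (toPolyChange v (monomial m c)).coeff m.degree = C (c * ∏ i : Fin n, v i ^ m i.succ) := by
  rw [toPolyChange, aeval_monomial, Finsupp.prod_fintype _ _ (fun i => by simp),
    Fin.prod_univ_succ, Finsupp.degree_eq_sum, Fin.sum_univ_succ]
  simp only [Fin.cons_zero, Fin.cons_succ]
  have hA : (algebraMap R (Polynomial (MvPolynomial (Fin n) R)) c *
      Polynomial.X ^ m 0).natDegree ≤ m 0 := by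
    rw [Polynomial.algebraMap_apply]
    exact (Polynomial.natDegree_C_mul_le _ _).trans (Polynomial.natDegree_X_pow_le _)
  have hAcoeff : (algebraMap R (Polynomial (MvPolynomial (Fin n) R)) c *
      Polynomial.X ^ m 0).coeff (m 0) = C c := by
    rw [Polynomial.algebraMap_apply, Polynomial.coeff_C_mul, Polynomial.coeff_X_pow_self, mul_one]
    rfl
  have hB : (∏ i : Fin n, (Polynomial.C (X i) + Polynomial.C (C (v i)) * Polynomial.X) ^
      m i.succ).natDegree ≤ ∑ i : Fin n, m i.succ :=
    natDegree_prod_pow_le _ _ _ (fun i _ => natDegree_C_add_C_mul_X_le _ _)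
  have hBcoeff : (∏ i : Fin n, (Polynomial.C (X i) + Polynomial.C (C (v i)) * Polynomial.X) ^
      m i.succ).coeff (∑ i : Fin n, m i.succ) = ∏ i : Fin n, C (v i) ^ m i.succ := by
    rw [coeff_prod_pow_sum _ _ _ (fun i _ => natDegree_C_add_C_mul_X_le _ _)]
    exact Finset.prod_congr rfl (fun i _ => by rw [coeff_C_add_C_mul_X_one])
  have hC : C (c * ∏ i : Fin n, v i ^ m i.succ) = C c * ∏ i : Fin n, (C (v i) : MvPolynomial (Fin n) R) ^ m i.succ := by
    rw [map_mul, map_prod]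
    simp only [map_pow]
  rw [← mul_assoc, Polynomial.coeff_mul_add_eq_of_natDegree_le hA hB, hAcoeff, hBcoeff, hC]

/-- The shear does not raise the degree in `X_0` beyond the total degree.
[cite: GreuelPfister2002, Thm. 3.4.1 (proof)] -/
theorem natDegree_toPolyChange_le (v : Fin n → R) (f : MvPolynomial (Fin (n + 1)) R) :
    (toPolyChange v f).natDegree ≤ f.totalDegree := by
  conv_lhs => rw [f.as_sum, map_sum]
  refine Polynomial.natDegree_sum_le_of_forall_le _ _ fun m hm => ?_
  refine (natDegree_toPolyChange_monomial_le v m _).trans ?_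
  rw [Finsupp.degree_eq_sum, ← Finsupp.sum_fintype m (fun _ e => e) (fun _ => rfl)]
  exact le_totalDegree hm

/-- **Top coefficient after the shear.** The coefficient of `X_0^{deg f}` in `linearChange v f`,
viewed as a polynomial in `X_0` over `R[X_1, …, X_n]`, is the constant `f_d(1, v_1, …, v_n)`, where
`f_d` is the top homogeneous component of `f` (Greuel–Pfister 2002, proof of Thm. 3.4.1:
"`f_d(∑ m_{1j} y_j, …) = f_d(m_{11}, …, m_{n1}) · y_1^d +` lower terms in `y_1`").
[cite: GreuelPfister2002, Thm. 3.4.1 (proof)] -/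
theorem coeff_finSuccEquiv_linearChange_totalDegree (v : Fin n → R)
    (f : MvPolynomial (Fin (n + 1)) R) :
    (finSuccEquiv R n (linearChange v f)).coeff f.totalDegree =
      C (eval (Fin.cons 1 v) (homogeneousComponent f.totalDegree f)) := by
  classical
  rw [← toPolyChange_eq]
  set D := f.totalDegree with hD
  have hsum : toPolyChange v f = ∑ m ∈ f.support, toPolyChange v (monomial m (coeff m f)) := by
    conv_lhs => rw [f.as_sum]
    rw [map_sum]
  rw [hsum, Polynomial.finsetSum_coeff, homogeneousComponent_apply, map_sum, map_sum,
    Finset.sum_filter]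
  refine Finset.sum_congr rfl fun m hm => ?_
  split_ifs with hdeg
  · rw [← hdeg, coeff_toPolyChange_monomial_degree, eval_monomial,
      Finsupp.prod_fintype _ _ (fun i => by simp), Fin.prod_univ_succ]
    simp
  · rw [Polynomial.coeff_eq_zero_of_natDegree_lt]
    refine lt_of_le_of_lt (natDegree_toPolyChange_monomial_le v m _) (lt_of_le_of_ne ?_ hdeg)
    rw [hD, Finsupp.degree_eq_sum, ← Finsupp.sum_fintype m (fun _ e => e) (fun _ => rfl)]
    exact le_totalDegree hm

/-! ### The dehomogenised top component `f_d(1, Y_1, …, Y_n)` -/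

/-- The dehomogenisation `f_d(1, Y_1, …, Y_n) ∈ R[Y_1, …, Y_n]` of the top homogeneous component
`f_d`, `d = deg f`. [folklore] -/
def dehomTop (f : MvPolynomial (Fin (n + 1)) R) : MvPolynomial (Fin n) R :=
  aeval (Fin.cons 1 X : Fin (n + 1) → MvPolynomial (Fin n) R) (homogeneousComponent f.totalDegree f)

/-- `f_d(1, Y)(v) = f_d(1, v)`. [folklore] -/
theorem eval_dehomTop (f : MvPolynomial (Fin (n + 1)) R) (v : Fin n → R) :
    eval v (dehomTop f) = eval (Fin.cons 1 v) (homogeneousComponent f.totalDegree f) := by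
  have h : (MvPolynomial.aeval v).comp
      (MvPolynomial.aeval (Fin.cons 1 X : Fin (n + 1) → MvPolynomial (Fin n) R)) =
      MvPolynomial.aeval (Fin.cons 1 v) := by
    refine MvPolynomial.algHom_ext fun j => ?_
    refine Fin.cases ?_ (fun i => ?_) j <;> simp
  calc eval v (dehomTop f)
      = ((MvPolynomial.aeval v).comp (MvPolynomial.aeval
          (Fin.cons 1 X : Fin (n + 1) → MvPolynomial (Fin n) R)))
          (homogeneousComponent f.totalDegree f) := rfl
    _ = MvPolynomial.aeval (Fin.cons 1 v) (homogeneousComponent f.totalDegree f) := by rw [h]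
    _ = eval (Fin.cons 1 v) (homogeneousComponent f.totalDegree f) := rfl

/-- `f_d(1, Y)` as a sum of monomials: the monomial `X^m` of `f_d` contributes `c_m · Y^{tail m}`.
[folklore] -/
theorem dehomTop_eq_sum (f : MvPolynomial (Fin (n + 1)) R) :
    dehomTop f = ∑ m ∈ f.support with m.degree = f.totalDegree,
      monomial (Finsupp.tail m) (coeff m f) := by
  classical
  rw [dehomTop, homogeneousComponent_apply, map_sum]
  refine Finset.sum_congr rfl fun m _ => ?_
  rw [aeval_monomial, Finsupp.prod_fintype _ _ (fun i => by simp), Fin.prod_univ_succ]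
  simp only [Fin.cons_zero, one_pow, one_mul, Fin.cons_succ, algebraMap_eq]
  rw [monomial_eq, Finsupp.prod_fintype _ _ (fun i => by simp)]
  rfl

/-- `deg f_d(1, Y) ≤ d`. [folklore] -/
theorem totalDegree_dehomTop_le (f : MvPolynomial (Fin (n + 1)) R) :
    (dehomTop f).totalDegree ≤ f.totalDegree := by
  classical
  rw [dehomTop_eq_sum]
  refine (totalDegree_finsetSum _ _).trans (Finset.sup_le fun m hm => ?_)
  refine (totalDegree_monomial_le _ _).trans ?_
  rw [Finset.mem_filter] at hm
  have h2 := hm.2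
  rw [Finsupp.degree_eq_sum, Fin.sum_univ_succ] at h2
  rw [Finsupp.sum_fintype _ _ (fun _ => rfl)]
  simp only [Finsupp.tail_apply, id]
  omega

/-- **The dehomogenised top component of a nonzero polynomial is nonzero**: a monomial of top degree
`X^m` of `f` gives the monomial `Y^{tail m}` of `f_d(1, Y)` with the same (nonzero) coefficient,
since a monomial of degree `d` is determined by its tail. [folklore] -/
theorem dehomTop_ne_zero {f : MvPolynomial (Fin (n + 1)) R} (hf : f ≠ 0) : dehomTop f ≠ 0 := by
  classical
  -- a monomial of top degree
  obtain ⟨m₀, hm₀, hdeg₀⟩ : ∃ m₀ ∈ f.support, (m₀.sum fun _ e => e) = f.totalDegree := by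
    obtain ⟨m₀, hm₀, h⟩ := Finset.exists_mem_eq_sup f.support (support_nonempty.2 hf)
      (fun s : Fin (n + 1) →₀ ℕ => s.sum fun _ e => e)
    exact ⟨m₀, hm₀, h.symm⟩
  have hdeg₀' : m₀.degree = f.totalDegree := by
    rw [Finsupp.degree_eq_sum, ← Finsupp.sum_fintype m₀ (fun _ e => e) (fun _ => rfl)]; exact hdeg₀
  intro h0
  have hc : coeff (Finsupp.tail m₀) (dehomTop f) = coeff m₀ f := by
    rw [dehomTop_eq_sum, coeff_sum]
    rw [Finset.sum_eq_single_of_mem m₀ (Finset.mem_filter.2 ⟨hm₀, hdeg₀'⟩)]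
    · simp
    · intro m hm hne
      rw [coeff_monomial, if_neg]
      intro htail
      apply hne
      -- same degree and same tail ⇒ same monomial
      rw [Finset.mem_filter] at hm
      have h0 : m 0 = m₀ 0 := by
        have h1 := hm.2
        rw [← hdeg₀', Finsupp.degree_eq_sum, Finsupp.degree_eq_sum, Fin.sum_univ_succ,
          Fin.sum_univ_succ] at h1
        have h2 : ∑ i : Fin n, m i.succ = ∑ i : Fin n, m₀ i.succ := by
          have := congrArg (fun t : Fin n →₀ ℕ => ∑ i : Fin n, t i) htail
          simpa only [Finsupp.tail_apply] using this
        omega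
      ext j
      refine Fin.cases h0 (fun i => ?_) j
      have := DFunLike.congr_fun htail i
      simpa only [Finsupp.tail_apply] using this
  rw [h0, coeff_zero] at hc
  exact (mem_support_iff.1 hm₀) hc.symm

/-! ### The quantitative normalisation step -/

/-- **Linear Noether normalisation step with coefficients from a prescribed finite set** (the first
step of Greuel–Pfister 2002, Thm. 3.4.1 (5), made quantitative). Let `R` be an integral domain,
`0 ≠ f ∈ R[X_0, …, X_n]` of total degree `d`, and `S ⊆ R` finite with `#S > d`. Then there is
`v ∈ Sⁿ` such that after the shear `X_{i+1} ↦ X_{i+1} + v_i X_0` the polynomial `f` has degree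
exactly `d` in `X_0` with leading coefficient a NONZERO CONSTANT `c = f_d(1, v) ∈ R`. (With
`S = {0, 1, …, d}` this gives integer shears of height `≤ d`.) Proof: the coefficient of `X_0^d` is
`f_d(1, v)` (`coeff_finSuccEquiv_linearChange_totalDegree`), and `f_d(1, Y) ≠ 0` has degree `≤ d`, so
the Combinatorial Nullstellensatz gives a non-root in `Sⁿ`. [cite: GreuelPfister2002, Thm. 3.4.1 (proof)] -/
theorem exists_linearChange_leadingCoeff [IsDomain R] {f : MvPolynomial (Fin (n + 1)) R}
    (hf : f ≠ 0) (S : Finset R) (hS : f.totalDegree < S.card) :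
    ∃ v : Fin n → R, (∀ i, v i ∈ S) ∧
      (finSuccEquiv R n (linearChange v f)).natDegree = f.totalDegree ∧
      ∃ c : R, c ≠ 0 ∧ (finSuccEquiv R n (linearChange v f)).leadingCoeff = C c ∧
        c = eval (Fin.cons 1 v) (homogeneousComponent f.totalDegree f) := by
  classical
  -- a non-root of the dehomogenised top component in the box `Sⁿ`
  have hP : dehomTop f ≠ 0 := dehomTop_ne_zero hf
  obtain ⟨t, ht, htdeg⟩ : ∃ t ∈ (dehomTop f).support,
      (t.sum fun _ e => e) = (dehomTop f).totalDegree := by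
    obtain ⟨t, ht, h⟩ := Finset.exists_mem_eq_sup (dehomTop f).support (support_nonempty.2 hP)
      (fun s : Fin n →₀ ℕ => s.sum fun _ e => e)
    exact ⟨t, ht, h.symm⟩
  have htdeg' : (dehomTop f).totalDegree = t.degree := by
    rw [Finsupp.degree_eq_sum, ← Finsupp.sum_fintype t (fun _ e => e) (fun _ => rfl), htdeg]
  obtain ⟨v, hvS, hv⟩ := MvPolynomial.combinatorial_nullstellensatz_exists_eval_nonzero
    (dehomTop f) t (mem_support_iff.1 ht) htdeg' (fun _ => S) (fun i => by
      calc t i ≤ t.degree := by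
            rw [Finsupp.degree_eq_sum]
            exact Finset.single_le_sum (f := fun j => t j) (fun _ _ => Nat.zero_le _)
              (Finset.mem_univ i)
        _ = (dehomTop f).totalDegree := htdeg'.symm
        _ ≤ f.totalDegree := totalDegree_dehomTop_le f
        _ < S.card := hS)
  refine ⟨v, hvS, ?_⟩
  set c := eval (Fin.cons 1 v) (homogeneousComponent f.totalDegree f) with hc
  have hc0 : c ≠ 0 := by rwa [hc, ← eval_dehomTop]
  have hcoeff : (finSuccEquiv R n (linearChange v f)).coeff f.totalDegree = C c :=
    coeff_finSuccEquiv_linearChange_totalDegree v f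
  have hle : (finSuccEquiv R n (linearChange v f)).natDegree ≤ f.totalDegree := by
    rw [← toPolyChange_eq]; exact natDegree_toPolyChange_le v f
  have hne : (finSuccEquiv R n (linearChange v f)).coeff f.totalDegree ≠ 0 := by
    rw [hcoeff]; exact (map_ne_zero_iff _ (C_injective _ _)).2 hc0
  have hdeg : (finSuccEquiv R n (linearChange v f)).natDegree = f.totalDegree :=
    le_antisymm hle (Polynomial.le_natDegree_of_ne_zero hne)
  refine ⟨hdeg, c, hc0, ?_, rfl⟩
  rw [Polynomial.leadingCoeff, hdeg, hcoeff]

/-- **Field case: monic in `X_0` after a linear change and scaling.** Over a field `K`, for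
`0 ≠ f` of degree `d` and `S ⊆ K` finite with `#S > d`, some shear with coefficients in `S`
followed by multiplication by a nonzero scalar makes `f` MONIC of degree `d` as a polynomial in
`X_0` over `K[X_1, …, X_n]`; hence `X_0` is integral over `K[X_1, …, X_n]` modulo `f`
(Greuel–Pfister 2002, Thm. 3.4.1 (5): "`K[y_2, …, y_n] → A/⟨f⟩` is injective and finite … since
`y_1` satisfies an integral relation"). [cite: GreuelPfister2002, Thm. 3.4.1] -/
theorem exists_linearChange_monic {K : Type*} [Field K] {f : MvPolynomial (Fin (n + 1)) K}
    (hf : f ≠ 0) (S : Finset K) (hS : f.totalDegree < S.card) :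
    ∃ v : Fin n → K, (∀ i, v i ∈ S) ∧ ∃ c : K, c ≠ 0 ∧
      (finSuccEquiv K n (linearChange v (C c * f))).Monic ∧
      (finSuccEquiv K n (linearChange v (C c * f))).natDegree = f.totalDegree := by
  obtain ⟨v, hvS, hdeg, c, hc0, hlc, -⟩ := exists_linearChange_leadingCoeff hf S hS
  refine ⟨v, hvS, c⁻¹, inv_ne_zero hc0, ?_⟩
  have hmul : finSuccEquiv K n (linearChange v (C c⁻¹ * f)) =
      Polynomial.C (C c⁻¹) * finSuccEquiv K n (linearChange v f) := by
    rw [map_mul, map_mul, MvPolynomial.algHom_C, MvPolynomial.algebraMap_eq]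
    congr 1
    rw [finSuccEquiv_apply, eval₂Hom_C]
    rfl
  have hu : IsUnit (C c⁻¹ : MvPolynomial (Fin n) K) :=
    (isUnit_iff_ne_zero.2 (inv_ne_zero hc0)).map C
  refine ⟨?_, ?_⟩
  · rw [Polynomial.Monic, hmul, Polynomial.leadingCoeff_C_mul_of_isUnit hu, hlc, ← map_mul,
      inv_mul_cancel₀ hc0, map_one]
  · rw [hmul, Polynomial.natDegree_C_mul_of_isUnit hu, hdeg]

end Literature.RingTheory.NoetherNormalization
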